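import Literature.MathematicalPhysics.QuantumFieldTheory.Balaban1983to89.Node00.TransportOfRecordGaugeFixing
import Summits.QuantumFields.YangMills.Theorems.BalabanUVNodesN11TreeGaugeRooted

/-!
# DAG node N11 — THE BLOCK-COMB FOREST: the hard tree gauge UNDER THE δ-FUNCTION of def-T's one-step transport, UNCONDITIONALLY
# (p618524 `Node00/TransportOfRecordGaugeFixing` §3∕§4 with its peeling hypotheses `(hT, hv)` DISCHARGED at the axial combs of the blocks)

HEADER — WORK-UNIT METADATA.  Cell `pub-ymgap`, YM-PLAN Track A (HUMAN RULING D-0062), R134 fan-out seat `pub-ymgap-dag-n11-e` (g28) on node N11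
[B14]; route `BalabanUVNodes`, key K1⁹ `StabilityBRunRowsAtRecordR13SepCoPHV` = stmt-QuantumFields-27364 (helper, `--kind proof --supports 27364
--as helper`, count-neutral).  [I] = [Balaban1987RG1] (CMP 109), [III] = [Balaban1988Convergent] (CMP 119).  Over, BY NAME and unmodified: this seat's
g22 `Node00/TransportOfRecordGaugeFixing` (§3 `map_avg_eq_map_avg_glue_freeMeasure`, `integral_mul_comp_avg_eq_integral_freeMeasure_glue`,
`integrable_comp_glue_freeMeasure`, ★★ `kernelTransport_ae_eq_kernelTransport_freeMeasure_glue`; §4 ★★ `transportOfRecord_ae_eq_kernelTransport_freeMeasure_glue`),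
its g28 sibling `…N11TreeGaugeRooted` (★★ `exists_treeOrder_avoiding_of_label`), gen 15's `T4AxialGaugeSmallField` ∕ `T4AxialGaugeFixing` (`castSite`,
`castSite_add_e`, `combBonds`, `mem_combBonds`) and gen 16's `T4TreeGaugeFixing` (`noClosedLoop_combBonds`, `noClosedLoop_biUnion`, `glue`, `freeMeasure`),
`TorusGeometry` (`Site.blockSite`, `Site.blockOf_blockSite`, `Site.blockOf_emb`).

WHY.  §3∕§4 of `TransportOfRecordGaugeFixing` move the TREE GAUGE under the δ-function `∫dU δ(ŪV⁻¹)` of def-T's one-step transport (†): for a bond set `T`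
with a peeling order `TreeOrder T v r` WHOSE FRESH ENDS ARE NEVER BLOCK CENTRES (`hv`), the fibre integral runs over the free bonds only.  They were left
CONDITIONAL on `(hT, hv)`: gen 15's only inhabited order, the corner-rooted comb `treeOrder_combBonds` (fresh end = target), has the block's centre among
its fresh ends.  [I] p. 254 fixes «the axial gauge in the big blocks» — the union over the blocks `B(y)`, `y ∈ T^{(k+1)}`, of their axial combs, a forest
whose components (one per block) each contain exactly one centre `y`.  THIS FILE builds that forest on the tree's objects and discharges `(hT, hv)` for
it by the ROOTED peeling certificate of `…N11TreeGaugeRooted` (label = `blockOf`, roots = centres), for ANY finset `Y` of blocks (print gauges a region).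

OBJECTS (no `def`; spelled out in every statement).  For a coarse site `y ∈ T^{(j+1)}` the block `B(y) ⊂ T^{(j)}` is the integer box
`[lo y, hi y]`, `lo y κ = L·y_κ`, `hi y κ = L·y_κ + (L − 1)` (`TorusGeometry.Site.blockSite`); its COMB is gen 15's `combBonds (lo y) (hi y)`; the
BLOCK-COMB FOREST of `Y : Finset (Site P (j+1))` is `Y.biUnion (fun y => combBonds (lo y) (hi y))`.

WHAT THIS FILE PROVES (17 theorems + 1 private, 0 `def`, 0 `sorry`, standard axioms).
§1 BLOCKS AS BOXES (standing range `j + 1 ≤ m + K`): `castSite_blockLo_add` (`castSite (L·y + r) = blockSite y r`) · `blockOf_castSite_of_mem_box` (a box point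
   lies in `B(y)`) · `blockBox_nonwrapping` (`hi − lo = L − 1 < sitesPerDir j`) · ★ `blockOf_ends_of_mem_blockComb` (both ends of a comb bond lie in `B(y)`).
§2 THE FOREST: `blockOf_src_eq_blockOf_tgt_of_mem_blockCombs` · `noClosedLoop_blockCombs` (disjoint supports, `noClosedLoop_biUnion`) ·
   ★★ `exists_treeOrder_blockCombs_avoiding_emb` (`∃ v r, TreeOrder T_Y v r ∧ ∀ b ∈ T_Y, ∀ y, v b ≠ emb y`) · `exists_treeOrder_blockComb_avoiding_emb` (one block).
§3 THE HARD GAUGE UNDER δ(ŪV⁻¹), GENERIC LEVEL (any `GaugeGroup` with Haar data; `avg` measurable, fine-gauge invariant (+ `HaarAC`); `ρ` fine-gauge-invariant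
   measurable (+ integrable); ANY `U₀`, ANY `Y`): `map_eq_map_fixTo_blockCombs_of_fineGaugeInvariant` · `integral_mul_comp_avg_eq_integral_fixTo_blockCombs` ·
   `map_avg_eq_map_avg_glue_freeMeasure_blockCombs` · `integral_mul_comp_avg_eq_integral_freeMeasure_glue_blockCombs` ·
   `integrable_comp_glue_freeMeasure_blockCombs` · ★★ `kernelTransport_ae_eq_kernelTransport_freeMeasure_glue_blockCombs`.
§4 AT THE RECORD (`G = SU(N)`, torus `F.P K`, `k < K`): ★★★ `transportOfRecord_ae_eq_kernelTransport_freeMeasure_glue_blockCombs`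
   (`transportOfRecord k ρ =ᵐ[dV] kernelTransport (∏_{b ∉ T_Y} dU(b)) dV (Ū ∘ glue T_Y U₀) (ρ ∘ glue T_Y U₀)` — def-T's (†) fibre integral over the bonds OFF the block
   combs of `Y`, unconditionally) · ★★★ `transportOfRecord_ae_eq_kernelTransport_freeMeasure_glue_allBlockCombs_one` (`Y = univ`, `U₀ = 1`: [I] (0.13)–(0.16), the
   axial gauge `U = 1` on the comb of EVERY block, under the δ-function).

NOT IN THIS FILE: which region print gauges at step `k` ((P″_{k+1} ∪ Z_k^{∼5})ᶜ, [III] p. 265 — def-R∕def-T's regions; take `Y` := its blocks), any chart ∕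
Jacobian of the remaining fibre ((B4) concrete half), the hierarchical axial gauge `Ax_k(𝔅_k)` of [B8] (1.19) (lower levels), K0b's re-pin.

HONEST FRAMING.  Helper lane of K1⁹, count-neutral; [folklore] lattice combinatorics + compositions BY NAME of landed bookkeeping theorems; nothing of
Bałaban's ESTIMATES is asserted; (B4) ∕ (S-α) ∕ (O3′) NOT closed; N11 NOT discharged; K1⁹ NOT closed; counts unmoved (typed 28∕28 · discharged 5∕27).
One finite four-torus programme at fixed `ε = L^{−K}`; R4 closes only the conditional finite-𝕋⁴ rung `BalabanLadder.UV` — NOT ℝ⁴, NOT OS, NOT a mass gap,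
NOT Clay.  No `sorry`, `axiom`, `def`, `instance`, `notation`.  Sources (SHAPE ∕ bookkeeping only): [I] (0.13)–(0.16) pp. 254–255; [III] (1.5)–(1.6) p. 247,
(3.1) p. 264, p. 265 L.10–12.
-/

noncomputable section

open MeasureTheory Function Finset
open scoped ENNReal BigOperators

namespace Summit.QuantumFields.YangMills.Theorems.BalabanUVNodesN11TransportBlockCombGauge

open Literature.MathematicalPhysics.QuantumFieldTheory.Balaban1983to89
open Node00
open T4Continuum (T4Family)
open GaugeField (gaugeAct)
open T4AveragingDisintegration (kernelTransport transportK)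
open T4FiniteEpsInhabited (HaarAC)
open T4AxialGaugeFixing (TreeOrder combBonds mem_combBonds)
open T4AxialGaugeSmallField (castSite castSite_apply castSite_add_e)
open T4TreeGaugeFixing (NoClosedLoop Touches fixTo glue freeMeasure noClosedLoop_combBonds noClosedLoop_biUnion)
open B12FaddeevPopov016 (FineGauge FineGaugeInvariant)
open B7Prop1Explicit (e)
open B8Lemma1NonAbelian (e_nonneg)
open BalabanUVNodesN11TreeGaugeRooted (exists_treeOrder_avoiding_of_label)

variable {P : Params} {j : ℕ}

/-! ## §1  Blocks as integer boxes `[L·y, L·y + (L − 1)]` -/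

/-- `castSite (L·y + r) = blockSite y r`: the integer box point with offset `r ∈ {0,…,L−1}^d` from the corner `L·y` is `TorusGeometry`'s `blockSite y r`.
[folklore] -/
theorem castSite_blockLo_add (y : Site P (j + 1)) (r : Fin P.d → Fin P.L) :
    (castSite (fun κ => (((y κ).val * P.L + r κ : ℕ) : ℤ)) : Site P j) = Site.blockSite y r := by
  funext κ; simp only [castSite_apply, Site.blockSite, Int.cast_natCast]

/-- **A POINT OF THE BOX `[L·y, L·y + (L − 1)]` LIES IN THE BLOCK `B(y)`** (standing range). [folklore] -/
theorem blockOf_castSite_of_mem_box (hj : j + 1 ≤ P.m + P.K) (y : Site P (j + 1)) {x : Fin P.d → ℤ}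
    (hlo : (fun κ => (((y κ).val * P.L : ℕ) : ℤ)) ≤ x) (hhi : x ≤ fun κ => (((y κ).val * P.L + (P.L - 1) : ℕ) : ℤ)) :
    blockOf (castSite x : Site P j) = y := by
  have hL := P.hL.2
  have hr : ∀ κ, 0 ≤ x κ - (((y κ).val * P.L : ℕ) : ℤ) ∧ x κ - (((y κ).val * P.L : ℕ) : ℤ) < P.L := by
    intro κ
    have h1 := hlo κ
    have h2 := hhi κ
    simp only at h1 h2
    constructor <;> omega
  let r : Fin P.d → Fin P.L := fun κ => ⟨(x κ - (((y κ).val * P.L : ℕ) : ℤ)).toNat, by have := hr κ; omega⟩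
  have hx : x = fun κ => (((y κ).val * P.L + r κ : ℕ) : ℤ) := by
    funext κ; have := hr κ; simp only [r]; push_cast; omega
  rw [hx, castSite_blockLo_add, Site.blockOf_blockSite hj]

/-- **BLOCKS DO NOT WRAP** (standing range): `hi y κ − lo y κ = L − 1 < sitesPerDir j` — the non-wrapping hypothesis of gen 15's `treeOrder_combBonds` for the
box of a block. [folklore] -/
theorem blockBox_nonwrapping (hj : j + 1 ≤ P.m + P.K) (y : Site P (j + 1)) (κ : Fin P.d) :
    (fun κ => (((y κ).val * P.L + (P.L - 1) : ℕ) : ℤ)) κ - (fun κ => (((y κ).val * P.L : ℕ) : ℤ)) κ < (P.sitesPerDir j : ℤ) := by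
  have hL := P.hL.2
  have h1 : P.L ≤ P.sitesPerDir j := by
    rw [P.sitesPerDir_eq_mul_succ hj]
    exact Nat.le_mul_of_pos_left _ (Nat.pos_of_ne_zero (P.sitesPerDir_ne_zero _))
  simp only
  omega

/-- ★ **BOTH ENDS OF A COMB BOND OF `B(y)` LIE IN `B(y)`**: for `b ∈ combBonds (lo y) (hi y)`, `blockOf b.src = y` and `blockOf b.tgt = y`. [folklore] -/
theorem blockOf_ends_of_mem_blockComb (hj : j + 1 ≤ P.m + P.K) (y : Site P (j + 1)) {b : PBond P j}
    (hb : b ∈ combBonds (fun κ => (((y κ).val * P.L : ℕ) : ℤ)) (fun κ => (((y κ).val * P.L + (P.L - 1) : ℕ) : ℤ))) :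
    blockOf b.src = y ∧ blockOf b.tgt = y := by
  obtain ⟨x, hlo, hhi, hsrc, -⟩ := mem_combBonds.1 hb
  have hx' : x ≤ fun κ => (((y κ).val * P.L + (P.L - 1) : ℕ) : ℤ) := (le_add_of_nonneg_right (e_nonneg _)).trans hhi
  have hlo' : (fun κ => (((y κ).val * P.L : ℕ) : ℤ)) ≤ x + e b.dir := hlo.trans (le_add_of_nonneg_right (e_nonneg _))
  refine ⟨?_, ?_⟩
  · rw [hsrc]; exact blockOf_castSite_of_mem_box hj y hlo hx'
  · rw [PBond.tgt, hsrc, ← castSite_add_e]; exact blockOf_castSite_of_mem_box hj y hlo' hhi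

/-! ## §2  The block-comb forest of a finset `Y` of blocks: loop-free, rooted at the centres -/

section Forest

variable [DecidableEq (PBond P j)]

/-- The block label is constant along every bond of the block-comb forest. [folklore] -/
theorem blockOf_src_eq_blockOf_tgt_of_mem_blockCombs (hj : j + 1 ≤ P.m + P.K) (Y : Finset (Site P (j + 1))) {b : PBond P j}
    (hb : b ∈ Y.biUnion fun y => combBonds (fun κ => (((y κ).val * P.L : ℕ) : ℤ)) (fun κ => (((y κ).val * P.L + (P.L - 1) : ℕ) : ℤ))) :
    blockOf b.src = blockOf b.tgt := by
  obtain ⟨y, -, hby⟩ := Finset.mem_biUnion.1 hb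
  obtain ⟨h1, h2⟩ := blockOf_ends_of_mem_blockComb hj y hby
  rw [h1, h2]

/-- **THE BLOCK-COMB FOREST IS LOOP-FREE**: the combs of distinct blocks touch no common site (their ends carry distinct block labels), and each comb is
loop-free on its non-wrapping box (gen 16's `noClosedLoop_combBonds`, `noClosedLoop_biUnion`). [folklore] -/
theorem noClosedLoop_blockCombs (hj : j + 1 ≤ P.m + P.K) (Y : Finset (Site P (j + 1))) :
    NoClosedLoop (Y.biUnion fun y =>
      (combBonds (fun κ => (((y κ).val * P.L : ℕ) : ℤ)) (fun κ => (((y κ).val * P.L + (P.L - 1) : ℕ) : ℤ)) : Finset (PBond P j))) := by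
  refine noClosedLoop_biUnion Y _ (fun y _ => noClosedLoop_combBonds fun κ => blockBox_nonwrapping hj y κ) ?_
  intro y _ y' _ hyy' b hb b' hb' x hbx hb'x
  apply hyy'
  obtain ⟨h1, h2⟩ := blockOf_ends_of_mem_blockComb hj y hb
  obtain ⟨h1', h2'⟩ := blockOf_ends_of_mem_blockComb hj y' hb'
  have hx : blockOf x = y := by
    rcases hbx with h | h
    · rw [← h]; exact h1
    · rw [← h]; exact h2
  have hx' : blockOf x = y' := by
    rcases hb'x with h | h
    · rw [← h]; exact h1'
    · rw [← h]; exact h2'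
  exact hx.symm.trans hx'

/-- ★★ **THE BLOCK-COMB FOREST CARRIES A PEELING ORDER WHOSE FRESH ENDS AVOID EVERY CENTRE** — the hypotheses `(hT, hv)` of p618524 §3∕§4, INHABITED: label `blockOf`
(constant along the forest), roots = the centres `emb y` (one label each, `blockOf ∘ emb = id`), and `…N11TreeGaugeRooted.exists_treeOrder_avoiding_of_label`.
[folklore] -/
theorem exists_treeOrder_blockCombs_avoiding_emb (hj : j + 1 ≤ P.m + P.K) (Y : Finset (Site P (j + 1))) :
    ∃ (v : PBond P j → Site P j) (r : Site P j → ℕ),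
      TreeOrder (Y.biUnion fun y => combBonds (fun κ => (((y κ).val * P.L : ℕ) : ℤ)) (fun κ => (((y κ).val * P.L + (P.L - 1) : ℕ) : ℤ))) v r ∧
      ∀ b ∈ (Y.biUnion fun y => combBonds (fun κ => (((y κ).val * P.L : ℕ) : ℤ)) (fun κ => (((y κ).val * P.L + (P.L - 1) : ℕ) : ℤ))),
        ∀ y : Site P (j + 1), v b ≠ emb y := by
  obtain ⟨v, r, hT, hv⟩ := exists_treeOrder_avoiding_of_label (noClosedLoop_blockCombs hj Y) blockOf
    (fun b hb => blockOf_src_eq_blockOf_tgt_of_mem_blockCombs hj Y hb) (Set.range (emb : Site P (j + 1) → Site P j))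
    (by
      rintro _ ⟨y, rfl⟩ _ ⟨y', rfl⟩ h
      rw [Site.blockOf_emb hj, Site.blockOf_emb hj] at h
      rw [h])
  exact ⟨v, r, hT, fun b hb y h => hv b hb ⟨y, h.symm⟩⟩

/-- **ONE BLOCK**: the comb of `B(y)` alone carries a peeling order whose fresh ends avoid every centre (the forest of `Y = {y}`). [folklore] -/
theorem exists_treeOrder_blockComb_avoiding_emb (hj : j + 1 ≤ P.m + P.K) (y : Site P (j + 1)) :
    ∃ (v : PBond P j → Site P j) (r : Site P j → ℕ),
      TreeOrder (combBonds (fun κ => (((y κ).val * P.L : ℕ) : ℤ)) (fun κ => (((y κ).val * P.L + (P.L - 1) : ℕ) : ℤ))) v r ∧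
      ∀ b ∈ combBonds (fun κ => (((y κ).val * P.L : ℕ) : ℤ)) (fun κ => (((y κ).val * P.L + (P.L - 1) : ℕ) : ℤ)),
        ∀ y' : Site P (j + 1), v b ≠ emb y' := by
  have h := exists_treeOrder_blockCombs_avoiding_emb hj ({y} : Finset (Site P (j + 1)))
  rwa [Finset.singleton_biUnion] at h

end Forest

/-! ## §3  The hard tree gauge under δ(ŪV⁻¹) at the block combs — generic level, any gauge group with Haar data -/

section Hard

variable {G : Type*} [GaugeGroup G] [MeasurableSpace G] [HaarData G] [MeasurableMul G]
variable [DecidableEq (PBond P j)]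

/-- **LAW FORM OF THE BLOCK-COMB GAUGE FOR FINE-GAUGE-INVARIANT OBSERVABLES**: a measurable observable `Φ` (into any measurable space) invariant under the fine
gauge group has the same law under `dU` as `Φ ∘ (·)[T_Y := U₀]` (p618524 `map_eq_map_fixTo_of_fineGaugeInvariant` at the inhabited order). [folklore] -/
theorem map_eq_map_fixTo_blockCombs_of_fineGaugeInvariant (hj : j + 1 ≤ P.m + P.K) (Y : Finset (Site P (j + 1)))
    {γ : Type*} [MeasurableSpace γ] {Φ : GaugeField P j G → γ} (hΦ : Measurable Φ)
    (hinv : ∀ u : GaugeTransf P j G, FineGauge u → ∀ U, Φ (gaugeAct u U) = Φ U) (U₀ : GaugeField P j G) :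
    (fieldMeasure P j G).map Φ =
      (fieldMeasure P j G).map (fun U => Φ (fixTo (Y.biUnion fun y => combBonds (fun κ => (((y κ).val * P.L : ℕ) : ℤ))
        (fun κ => (((y κ).val * P.L + (P.L - 1) : ℕ) : ℤ))) U₀ U)) := by
  obtain ⟨v, r, hT, hv⟩ := exists_treeOrder_blockCombs_avoiding_emb hj Y
  exact map_eq_map_fixTo_of_fineGaugeInvariant hT hv hΦ hinv U₀

/-- **THE PAIRING IN THE BLOCK-COMB GAUGE (prescribed values)**: `∫dU ρ(U) f(Ū U) = ∫dU ρ(U[T_Y := U₀]) f(Ū(U[T_Y := U₀]))` for fine-gauge-invariant measurable `ρ`,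
measurable `f`, any `Y`, any `U₀` (p618524 `integral_mul_comp_avg_eq_integral_fixTo` at the inhabited order). [folklore] -/
theorem integral_mul_comp_avg_eq_integral_fixTo_blockCombs (hj : j + 1 ≤ P.m + P.K) (Y : Finset (Site P (j + 1)))
    {avg : GaugeField P j G → GaugeField P (j + 1) G} (havg : Measurable avg)
    (havgInv : ∀ u : GaugeTransf P j G, FineGauge u → ∀ U, avg (gaugeAct u U) = avg U)
    {ρ : Density P j G} (hρm : Measurable ρ) (hρ : FineGaugeInvariant ρ)
    {f : GaugeField P (j + 1) G → ℝ} (hf : Measurable f) (U₀ : GaugeField P j G) :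
    ∫ U, ρ U * f (avg U) ∂fieldMeasure P j G =
      ∫ U, ρ (fixTo (Y.biUnion fun y => combBonds (fun κ => (((y κ).val * P.L : ℕ) : ℤ))
            (fun κ => (((y κ).val * P.L + (P.L - 1) : ℕ) : ℤ))) U₀ U) *
          f (avg (fixTo (Y.biUnion fun y => combBonds (fun κ => (((y κ).val * P.L : ℕ) : ℤ))
            (fun κ => (((y κ).val * P.L + (P.L - 1) : ℕ) : ℤ))) U₀ U)) ∂fieldMeasure P j G := by
  obtain ⟨v, r, hT, hv⟩ := exists_treeOrder_blockCombs_avoiding_emb hj Y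
  exact integral_mul_comp_avg_eq_integral_fixTo hT hv havg havgInv hρm hρ hf U₀

/-- **THE COARSE LAW IS NOT MOVED BY THE BLOCK-COMB GAUGE**: `Ū_*(dU) = (Ū ∘ glue T_Y U₀)_*(∏_{b ∉ T_Y} dU(b))` for an averaging invariant under the fine gauge group,
any `Y`, any `U₀` (p618524 `map_avg_eq_map_avg_glue_freeMeasure` at the inhabited order). [folklore] -/
theorem map_avg_eq_map_avg_glue_freeMeasure_blockCombs (hj : j + 1 ≤ P.m + P.K) (Y : Finset (Site P (j + 1)))
    {avg : GaugeField P j G → GaugeField P (j + 1) G} (havg : Measurable avg)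
    (havgInv : ∀ u : GaugeTransf P j G, FineGauge u → ∀ U, avg (gaugeAct u U) = avg U) (U₀ : GaugeField P j G) :
    (fieldMeasure P j G).map avg =
      (freeMeasure (Y.biUnion fun y => combBonds (fun κ => (((y κ).val * P.L : ℕ) : ℤ))
        (fun κ => (((y κ).val * P.L + (P.L - 1) : ℕ) : ℤ)))).map
        (fun W => avg (glue (Y.biUnion fun y => combBonds (fun κ => (((y κ).val * P.L : ℕ) : ℤ))
          (fun κ => (((y κ).val * P.L + (P.L - 1) : ℕ) : ℤ))) U₀ W)) := by
  obtain ⟨v, r, hT, hv⟩ := exists_treeOrder_blockCombs_avoiding_emb hj Y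
  exact map_avg_eq_map_avg_glue_freeMeasure hT hv havg havgInv U₀

/-- **THE PAIRING OVER THE BONDS OFF THE BLOCK COMBS**: `∫dU ρ(U) f(Ū U) = ∫ ∏_{b ∉ T_Y} dU(b) ρ(glue T_Y U₀ W) f(Ū(glue T_Y U₀ W))` for fine-gauge-invariant measurable
`ρ` and measurable `f` (p618524 `integral_mul_comp_avg_eq_integral_freeMeasure_glue` at the inhabited order). [folklore] -/
theorem integral_mul_comp_avg_eq_integral_freeMeasure_glue_blockCombs (hj : j + 1 ≤ P.m + P.K) (Y : Finset (Site P (j + 1)))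
    {avg : GaugeField P j G → GaugeField P (j + 1) G} (havg : Measurable avg)
    (havgInv : ∀ u : GaugeTransf P j G, FineGauge u → ∀ U, avg (gaugeAct u U) = avg U)
    {ρ : Density P j G} (hρm : Measurable ρ) (hρ : FineGaugeInvariant ρ)
    {f : GaugeField P (j + 1) G → ℝ} (hf : Measurable f) (U₀ : GaugeField P j G) :
    ∫ U, ρ U * f (avg U) ∂fieldMeasure P j G =
      ∫ W, ρ (glue (Y.biUnion fun y => combBonds (fun κ => (((y κ).val * P.L : ℕ) : ℤ))
            (fun κ => (((y κ).val * P.L + (P.L - 1) : ℕ) : ℤ))) U₀ W) *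
          f (avg (glue (Y.biUnion fun y => combBonds (fun κ => (((y κ).val * P.L : ℕ) : ℤ))
            (fun κ => (((y κ).val * P.L + (P.L - 1) : ℕ) : ℤ))) U₀ W))
        ∂freeMeasure (Y.biUnion fun y => combBonds (fun κ => (((y κ).val * P.L : ℕ) : ℤ))
          (fun κ => (((y κ).val * P.L + (P.L - 1) : ℕ) : ℤ))) := by
  obtain ⟨v, r, hT, hv⟩ := exists_treeOrder_blockCombs_avoiding_emb hj Y
  exact integral_mul_comp_avg_eq_integral_freeMeasure_glue hT hv havg havgInv hρm hρ hf U₀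

/-- An integrable fine-gauge-invariant measurable density stays integrable when read on the bonds off the block combs (p618524 `integrable_comp_glue_freeMeasure` at
the inhabited order). [folklore] -/
theorem integrable_comp_glue_freeMeasure_blockCombs (hj : j + 1 ≤ P.m + P.K) (Y : Finset (Site P (j + 1)))
    {ρ : Density P j G} (hρm : Measurable ρ) (hρ : FineGaugeInvariant ρ) (hρi : Integrable ρ (fieldMeasure P j G))
    (U₀ : GaugeField P j G) :
    Integrable (fun W => ρ (glue (Y.biUnion fun y => combBonds (fun κ => (((y κ).val * P.L : ℕ) : ℤ))
        (fun κ => (((y κ).val * P.L + (P.L - 1) : ℕ) : ℤ))) U₀ W))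
      (freeMeasure (G := G) (Y.biUnion fun y => combBonds (fun κ => (((y κ).val * P.L : ℕ) : ℤ))
        (fun κ => (((y κ).val * P.L + (P.L - 1) : ℕ) : ℤ)))) := by
  obtain ⟨v, r, hT, hv⟩ := exists_treeOrder_blockCombs_avoiding_emb hj Y
  exact integrable_comp_glue_freeMeasure hT hv hρm hρ hρi U₀

variable [StandardBorelSpace G]

/-- ★★ **THE BLOCK-COMB GAUGE UNDER THE δ-FUNCTION, GENERIC LEVEL.**  For an averaging map `Ū` that is measurable, `HaarAC` and invariant under the fine gauge group, a
fine-gauge-invariant integrable measurable `ρ`, ANY finset `Y` of blocks and ANY prescribed values `U₀`: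
`transportK Ū ρ =ᵐ[dV] kernelTransport (∏_{b ∉ T_Y} dU(b)) dV (Ū ∘ glue T_Y U₀) (ρ ∘ glue T_Y U₀)` — the fibre integral of (†) runs over the bonds OFF the combs of the blocks
of `Y` only (p618524 `kernelTransport_ae_eq_kernelTransport_freeMeasure_glue`, its `(hT, hv)` discharged by §2). [folklore] -/
theorem kernelTransport_ae_eq_kernelTransport_freeMeasure_glue_blockCombs (hj : j + 1 ≤ P.m + P.K) (Y : Finset (Site P (j + 1)))
    {avg : GaugeField P j G → GaugeField P (j + 1) G} (havg : Measurable avg) (hac : HaarAC avg)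
    (havgInv : ∀ u : GaugeTransf P j G, FineGauge u → ∀ U, avg (gaugeAct u U) = avg U)
    {ρ : Density P j G} (hρm : Measurable ρ) (hρ : FineGaugeInvariant ρ) (hρi : Integrable ρ (fieldMeasure P j G))
    (U₀ : GaugeField P j G) :
    transportK avg ρ =ᵐ[fieldMeasure P (j + 1) G]
      kernelTransport
        (freeMeasure (Y.biUnion fun y => combBonds (fun κ => (((y κ).val * P.L : ℕ) : ℤ))
          (fun κ => (((y κ).val * P.L + (P.L - 1) : ℕ) : ℤ))))
        (fieldMeasure P (j + 1) G)
        (fun W => avg (glue (Y.biUnion fun y => combBonds (fun κ => (((y κ).val * P.L : ℕ) : ℤ))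
          (fun κ => (((y κ).val * P.L + (P.L - 1) : ℕ) : ℤ))) U₀ W))
        (fun W => ρ (glue (Y.biUnion fun y => combBonds (fun κ => (((y κ).val * P.L : ℕ) : ℤ))
          (fun κ => (((y κ).val * P.L + (P.L - 1) : ℕ) : ℤ))) U₀ W)) := by
  obtain ⟨v, r, hT, hv⟩ := exists_treeOrder_blockCombs_avoiding_emb hj Y
  exact kernelTransport_ae_eq_kernelTransport_freeMeasure_glue hT hv havg hac havgInv hρm hρ hρi U₀

end Hard

/-! ## §4  At the record: `G = SU(N)`, the torus `F.P K`, def-T's `transportOfRecord F N K k` along `avOfRecord F N K k` -/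

section Record

variable (F : T4Family) (N : ℕ) [NeZero N]

/-- The standing range `k + 1 ≤ m + K` of the `K`-th torus from `k < K` (bookkeeping). [folklore] -/
private theorem succ_le_m_add_K_of_lt {K k : ℕ} (hk : k < K) : k + 1 ≤ (F.P K).m + (F.P K).K := by
  simp only [T4Family.P_K, T4Family.P_m]; omega

/-- ★★★ **THE BLOCK-COMB GAUGE UNDER THE δ-FUNCTION OF THE TRANSPORT OF RECORD, UNCONDITIONALLY**: for `k < K`, ANY finset `Y` of blocks of `T^{(k+1)}`, a
fine-gauge-invariant integrable measurable `ρ` and ANY `U₀`,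
`transportOfRecord k ρ = kernelTransport (∏_{b ∉ T_Y} dU(b)) dV (Ū ∘ glue T_Y U₀) (ρ ∘ glue T_Y U₀)` `dV`-a.e. — def-T's fibre integral over the bonds OFF the combs of the blocks of `Y`
(p618524 ★★ `transportOfRecord_ae_eq_kernelTransport_freeMeasure_glue` with `(hT, hv)` := §2). [folklore] -/
theorem transportOfRecord_ae_eq_kernelTransport_freeMeasure_glue_blockCombs {K k : ℕ} (hk : k < K)
    [DecidableEq (PBond (F.P K) k)] (Y : Finset (Site (F.P K) (k + 1)))
    {ρ : Density (F.P K) k (SU N)} (hρm : Measurable ρ) (hρ : FineGaugeInvariant ρ)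
    (hρi : Integrable ρ (fieldMeasure (F.P K) k (SU N))) (U₀ : GaugeField (F.P K) k (SU N)) :
    transportOfRecord F N K k ρ =ᵐ[fieldMeasure (F.P K) (k + 1) (SU N)]
      kernelTransport
        (freeMeasure (Y.biUnion fun y => combBonds (fun κ => (((y κ).val * (F.P K).L : ℕ) : ℤ))
          (fun κ => (((y κ).val * (F.P K).L + ((F.P K).L - 1) : ℕ) : ℤ))))
        (fieldMeasure (F.P K) (k + 1) (SU N))
        (fun W => (avOfRecord F N K k).avg (glue (Y.biUnion fun y => combBonds (fun κ => (((y κ).val * (F.P K).L : ℕ) : ℤ))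
          (fun κ => (((y κ).val * (F.P K).L + ((F.P K).L - 1) : ℕ) : ℤ))) U₀ W))
        (fun W => ρ (glue (Y.biUnion fun y => combBonds (fun κ => (((y κ).val * (F.P K).L : ℕ) : ℤ))
          (fun κ => (((y κ).val * (F.P K).L + ((F.P K).L - 1) : ℕ) : ℤ))) U₀ W)) := by
  obtain ⟨v, r, hT, hv⟩ := exists_treeOrder_blockCombs_avoiding_emb (succ_le_m_add_K_of_lt F hk) Y
  exact transportOfRecord_ae_eq_kernelTransport_freeMeasure_glue F N hk hT hv hρm hρ hρi U₀

/-- ★★★ **[I] (0.13)–(0.16) UNDER THE δ-FUNCTION: THE AXIAL GAUGE `U = 1` ON THE COMB OF EVERY BLOCK.**  For `k < K` and a fine-gauge-invariant integrable measurable `ρ`,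
with `T := ⋃_{y ∈ T^{(k+1)}} comb(B(y))`: `transportOfRecord k ρ = kernelTransport (∏_{b ∉ T} dU(b)) dV (Ū ∘ glue T 1) (ρ ∘ glue T 1)` `dV`-a.e. — def-T's (†) computed on the
configurations that are `1` on every block comb, integrating over the remaining bonds only. [folklore] -/
theorem transportOfRecord_ae_eq_kernelTransport_freeMeasure_glue_allBlockCombs_one {K k : ℕ} (hk : k < K)
    [DecidableEq (PBond (F.P K) k)]
    {ρ : Density (F.P K) k (SU N)} (hρm : Measurable ρ) (hρ : FineGaugeInvariant ρ)
    (hρi : Integrable ρ (fieldMeasure (F.P K) k (SU N))) :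
    transportOfRecord F N K k ρ =ᵐ[fieldMeasure (F.P K) (k + 1) (SU N)]
      kernelTransport
        (freeMeasure ((Finset.univ : Finset (Site (F.P K) (k + 1))).biUnion fun y =>
          combBonds (fun κ => (((y κ).val * (F.P K).L : ℕ) : ℤ)) (fun κ => (((y κ).val * (F.P K).L + ((F.P K).L - 1) : ℕ) : ℤ))))
        (fieldMeasure (F.P K) (k + 1) (SU N))
        (fun W => (avOfRecord F N K k).avg (glue ((Finset.univ : Finset (Site (F.P K) (k + 1))).biUnion fun y =>
          combBonds (fun κ => (((y κ).val * (F.P K).L : ℕ) : ℤ)) (fun κ => (((y κ).val * (F.P K).L + ((F.P K).L - 1) : ℕ) : ℤ)))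
          (fun _ => 1) W))
        (fun W => ρ (glue ((Finset.univ : Finset (Site (F.P K) (k + 1))).biUnion fun y =>
          combBonds (fun κ => (((y κ).val * (F.P K).L : ℕ) : ℤ)) (fun κ => (((y κ).val * (F.P K).L + ((F.P K).L - 1) : ℕ) : ℤ)))
          (fun _ => 1) W)) :=
  transportOfRecord_ae_eq_kernelTransport_freeMeasure_glue_blockCombs F N hk Finset.univ hρm hρ hρi fun _ => 1

end Record

end Summit.QuantumFields.YangMills.Theorems.BalabanUVNodesN11TransportBlockCombGauge
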